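import Literature.NumberTheory.EllipticCurves.Sprung2012.SharpFlatSelmer
import Literature.NumberTheory.EllipticCurves.Selmer
import HarnessLib

/-!
# Sprung's `X^{♯/♭}(E/ℚ_∞)` at the ORDER-2 CHARACTER of `Γ` (`p = 2`, `γ ↦ −1`, `T ↦ −2`):
# the `(T+2)`-coinvariants, a CONTROL predicate against `Sel_{2^∞}` of the `χ₈`-twist, and a
# `ℤ₂`-CORANK predicate (carriers; definitions only)

Topic `Literature/NumberTheory/EllipticCurves`, cluster `Sprung2012` (namespace = path). DEFINITIONS WITH
BODIES and proved unfolding lemmas only: no theorem of the literature is asserted, no named fact (D-0014,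
D-0026). Requested by cell `bsd-f1-sign2` (definition request D-ty-1 of MEMO-an §5; shape agreed with the
planner, STATUS 2026-08-27T15:56:17Z; refuter trap REF1-CARRIERS-AT2 v1.5 **T16** read: the predicates are
parametrised by the WHOLE `SharpFlatSelmerDualData` signature `(W, κ, γ, ι, ap, g, c, col)` and assert
nothing; the Honda-system / `ap = a₂(E)` / cyclotomic pins belong to the CLOSED statements that quantify
over `D`, which are the cell's own candidate statements and live under `Summits/…/F1Sign2/`, never here).

## Mathematics

`Λ = ℤ₂⟦T⟧`, `T = γ − 1` for a topological generator `γ` of `Γ = Gal(ℚ_∞/ℚ) ≅ ℤ₂` (cyclotomic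
`ℤ₂`-extension). At `p = 2` — and only there — `Γ` has a character of ORDER 2, `χ : γ ↦ −1`; its fixed
field is the first layer `ℚ₁ = ℚ(√2)`, and as a Dirichlet character it is `χ₈`. Evaluating `T = γ − 1` at
`χ` gives `T = −2`, so for a `Λ`-module `X` the `χ`-COINVARIANTS are `X_χ = X / (γ − χ(γ))X = X / (T+2)X`
(`orderTwoCharElement = T + 2`, prime in `Λ` since `Λ/(T+2) ≅ ℤ₂`; `coinvAtNegTwoSubmodule X = (T+2)·X`).
For Sprung's chromatic dual Selmer module `X = X^•(E/ℚ_∞) = D.X` (`SharpFlatSelmerDualData`, Def. 7.9/7.11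
of [Sprung2012] transcribed in `Sprung2012/SharpFlatSelmer.lean`), a CONTROL statement at `χ` compares
`X^•/(T+2)` with the `2^∞`-Selmer group of `E` over `ℚ₁` cut to the `χ`-part, i.e. with
`Sel_{2^∞}(E^{(2)}/ℚ)` of the quadratic twist `E^{(2)} = E ⊗ χ₈` (tree `selmerGroupPInfty W₂ 2`,
`W.quadraticTwist 2`), up to a finite LOCAL INDEX at the prime above `2` (the •-condition is not the Kummer
condition). This file gives the two shapes the cell consumes, as PREDICATES with the index / corank as
explicit parameters:

* `SharpFlatControlAtNegTwo D W₂ e` (shape (A), for the ♯-bookkeeping candidate AN-2 at analytic rank 0):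
  `X^•/(T+2)` and `Sel_{2^∞}(W₂/ℚ)` are finite and `#(X^•/(T+2)) = 2^e · #Sel_{2^∞}(W₂/ℚ)`;
* `SharpFlatCorankAtNegTwo D n` (shape (B), for the ♭/♯ twins of the order law AN-5): `X^•` is a finitely
  generated `Λ`-module and `X^•/(T+2)` has `ℤ₂`-corank `n`, phrased `Λ`-linearly: it contains a copy of
  `(Λ/(T+2))^n ≅ ℤ₂^n` of finite index.

In print, control theorems for the ± / ♯♭ Selmer groups at finite layers and characters are `p` ODD
(Kobayashi 2003 Thm. 9.3; Sprung 2012 §7 "From now on, assume p is odd"; B. D. Kim 2013); the `p = 2`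
statements built on these predicates are the cell's candidate statements (`Summits/…/F1Sign2/`), not facts of the literature.

References: [Sprung2012] F. Sprung, J. Number Theory 132 (2012), Def. 7.9, 7.11 (p. 1503), §7 (p odd);
[Kobayashi2003] S. Kobayashi, Invent. Math. 152 (2003), Thm. 9.3 (control, p odd); [Greenberg1999]
R. Greenberg, LNM 1716, §1 (the `Λ`-action, `T = γ − 1`), §2 (`Sel_{p^∞}`).
-/

noncomputable section

open scoped Classical

open NumberField IsDedekindDomain Polynomial

universe u

namespace Literature.NumberTheory.EllipticCurves.Sprung2012

open Literature.NumberTheory.EllipticCurves Literature.NumberTheory.GaloisRepresentations ZpExtension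
  Literature.NumberTheory.EllipticCurves.Kobayashi2003 Literature.NumberTheory.EllipticCurves.Sprung2017
  WeierstrassCurve

/-! ### The order-2 character of `Γ` at `p = 2` as an element of `Λ₂` -/

/-- **`T + 2 ∈ Λ₂ = ℤ₂⟦T⟧`** — the element `γ − χ(γ)` for the ORDER-2 character `χ : γ ↦ −1` of
`Γ ≅ ℤ₂` (`T = γ − 1 ↦ −2`; first layer `ℚ(√2)`, Dirichlet `χ₈`). `Λ₂/(T+2) ≅ ℤ₂`. [cite: Greenberg1999, §1 (T = γ − 1; the p = 2 order-2 specialisation is ours)] -/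
def orderTwoCharElement : IwasawaAlgebra 2 :=
  PowerSeries.X + PowerSeries.C (2 : ℤ_[2])

/-- Unfolding lemma. [cite: Greenberg1999, §1] -/
theorem orderTwoCharElement_def :
    orderTwoCharElement = PowerSeries.X + PowerSeries.C (2 : ℤ_[2]) :=
  rfl

/-- The constant term of `T + 2` is `2` (so `T + 2` is not a unit of `Λ₂`). [cite: Greenberg1999, §1] -/
theorem constantCoeff_orderTwoCharElement :
    PowerSeries.constantCoeff orderTwoCharElement = 2 := by
  simp [orderTwoCharElement]

/-- **The `χ`-coinvariant submodule `(T+2)·X`** of a `Λ₂`-module `X` (so that `X ⧸ coinvAtNegTwoSubmodule X`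
is `X_χ = X/(T+2)X`, the coinvariants at the order-2 character). [cite: Greenberg1999, §1 (coinvariants X/(γ − 1)X; the χ-twisted version is ours)] -/
def coinvAtNegTwoSubmodule (X : Type*) [AddCommGroup X] [Module (IwasawaAlgebra 2) X] :
    Submodule (IwasawaAlgebra 2) X :=
  Ideal.span {orderTwoCharElement} • ⊤

/-- `(T+2) • x` lies in `(T+2)·X`. [cite: Greenberg1999, §1] -/
theorem smul_mem_coinvAtNegTwoSubmodule {X : Type*} [AddCommGroup X] [Module (IwasawaAlgebra 2) X]
    (x : X) : orderTwoCharElement • x ∈ coinvAtNegTwoSubmodule X :=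
  Submodule.smul_mem_smul (Ideal.mem_span_singleton_self _) Submodule.mem_top

/-! ### The two predicates over Sprung's chromatic dual Selmer data (`K = ℚ`, `p = 2`) -/

section Predicates

variable {W : WeierstrassCurve ℚ} {κ : ZpExtension ℚ 2} {γ : Field.absoluteGaloisGroup ℚ}
  {E : Type} [Field E] [Algebra ℚ E] {ι : AlgebraicClosure ℚ →ₐ[ℚ] AlgebraicClosure E} {ap : ℤ}
  {g : Field.absoluteGaloisGroup E} {c : ℕ → localPoints W E} {col : Chroma}

/-- **Shape (A) — CONTROL AT THE ORDER-2 CHARACTER with local index `2^e` (predicate):** for Sprung's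
chromatic dual Selmer datum `D` (`D.X = X^•(E/ℚ_∞)`, `• = col`) and a curve `W₂/ℚ` (intended: a model of
the quadratic twist `W ⊗ χ₈`), the `χ`-coinvariants `X^•/(T+2)` are FINITE, the `2^∞`-Selmer group
`Sel_{2^∞}(W₂/ℚ)` (`selmerGroupPInfty W₂ 2`) is FINITE, and
`#(X^•/(T+2)) = 2^e · #Sel_{2^∞}(W₂/ℚ)`. A DEFINITION (parameters `D`, `W₂`, `e` explicit); nothing
asserted here; in print such control statements are for `p` odd (the `p = 2` statements built on this
predicate are the requesting cell's own, filed Summits-side). [cite: Sprung2012, Def. 7.9 and Def. 7.11 (the objects); Kobayashi2003, Thm. 9.3 (control, p odd; the p = 2 shape is ours)] -/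
def SharpFlatControlAtNegTwo (D : SharpFlatSelmerDualData W κ γ ι ap g c col) (W₂ : WeierstrassCurve ℚ)
    (e : ℕ) : Prop :=
  Finite (D.X ⧸ coinvAtNegTwoSubmodule D.X) ∧ Finite (selmerGroupPInfty W₂ 2) ∧
    Nat.card (D.X ⧸ coinvAtNegTwoSubmodule D.X) = 2 ^ e * Nat.card (selmerGroupPInfty W₂ 2)

/-- Unfolding lemma for `SharpFlatControlAtNegTwo`. [cite: Sprung2012, Def. 7.11 (shape only)] -/
theorem sharpFlatControlAtNegTwo_iff (D : SharpFlatSelmerDualData W κ γ ι ap g c col)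
    (W₂ : WeierstrassCurve ℚ) (e : ℕ) :
    SharpFlatControlAtNegTwo D W₂ e ↔
      Finite (D.X ⧸ coinvAtNegTwoSubmodule D.X) ∧ Finite (selmerGroupPInfty W₂ 2) ∧
        Nat.card (D.X ⧸ coinvAtNegTwoSubmodule D.X) = 2 ^ e * Nat.card (selmerGroupPInfty W₂ 2) :=
  Iff.rfl

/-- **Shape (B) — `ℤ₂`-CORANK `n` OF THE `χ`-COINVARIANTS (predicate):** `X^• = D.X` is a finitely
generated `Λ₂`-module and `X^•/(T+2)` contains a `Λ₂`-submodule isomorphic to `(Λ₂/(T+2))^n ≅ ℤ₂^n`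
with FINITE quotient — i.e. the coinvariants at the order-2 character have `ℤ₂`-corank exactly `n`
(phrased `Λ₂`-linearly through `Λ₂/(T+2) ≅ ℤ₂`, `T ↦ −2`, so no separate `ℤ₂`-module structure is
needed). A DEFINITION (parameters `D`, `n` explicit); nothing asserted. [cite: Sprung2012, Def. 7.9 and Def. 7.11 (the objects); Kobayashi2003, Thm. 9.3 (control, p odd; the corank-at-χ shape at p = 2 is ours)] -/
def SharpFlatCorankAtNegTwo (D : SharpFlatSelmerDualData W κ γ ι ap g c col) (n : ℕ) : Prop :=
  Module.Finite (IwasawaAlgebra 2) D.X ∧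
    ∃ φ : (Fin n → (IwasawaAlgebra 2 ⧸ Ideal.span {orderTwoCharElement})) →ₗ[IwasawaAlgebra 2]
        (D.X ⧸ coinvAtNegTwoSubmodule D.X),
      Function.Injective φ ∧ Finite ((D.X ⧸ coinvAtNegTwoSubmodule D.X) ⧸ LinearMap.range φ)

/-- Unfolding lemma for `SharpFlatCorankAtNegTwo`. [cite: Sprung2012, Def. 7.11 (shape only)] -/
theorem sharpFlatCorankAtNegTwo_iff (D : SharpFlatSelmerDualData W κ γ ι ap g c col) (n : ℕ) :
    SharpFlatCorankAtNegTwo D n ↔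
      Module.Finite (IwasawaAlgebra 2) D.X ∧
        ∃ φ : (Fin n → (IwasawaAlgebra 2 ⧸ Ideal.span {orderTwoCharElement})) →ₗ[IwasawaAlgebra 2]
            (D.X ⧸ coinvAtNegTwoSubmodule D.X),
          Function.Injective φ ∧ Finite ((D.X ⧸ coinvAtNegTwoSubmodule D.X) ⧸ LinearMap.range φ) :=
  Iff.rfl

/-- Corank `0` in shape (B) is finiteness of the `χ`-coinvariants (for a finitely generated `X^•`): the
only map out of `(Λ₂/(T+2))^0 = 0` is `0`, injective with range `⊥`. [cite: Sprung2012, Def. 7.11 (shape only; the bookkeeping is ours)] -/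
theorem sharpFlatCorankAtNegTwo_zero_iff (D : SharpFlatSelmerDualData W κ γ ι ap g c col) :
    SharpFlatCorankAtNegTwo D 0 ↔
      Module.Finite (IwasawaAlgebra 2) D.X ∧ Finite (D.X ⧸ coinvAtNegTwoSubmodule D.X) := by
  refine and_congr_right fun _ ↦ ⟨?_, ?_⟩
  · rintro ⟨φ, -, hfin⟩
    have hr : LinearMap.range φ = ⊥ := by
      rw [LinearMap.range_eq_bot]
      exact LinearMap.ext fun x ↦ by
        rw [Subsingleton.elim x 0, map_zero, LinearMap.zero_apply]
    rw [hr] at hfin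
    exact Finite.of_equiv _ (Submodule.quotEquivOfEqBot
      (⊥ : Submodule (IwasawaAlgebra 2) (D.X ⧸ coinvAtNegTwoSubmodule D.X)) rfl).toEquiv
  · intro hfin
    refine ⟨0, fun x y _ ↦ Subsingleton.elim x y, ?_⟩
    rw [LinearMap.range_zero]
    exact Finite.of_equiv _ (Submodule.quotEquivOfEqBot
      (⊥ : Submodule (IwasawaAlgebra 2) (D.X ⧸ coinvAtNegTwoSubmodule D.X)) rfl).symm.toEquiv

end Predicates

end Literature.NumberTheory.EllipticCurves.Sprung2012

end
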